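import Summits.SmoothPoincare4.SmoothPoincare4.Theorems.SoloInformedPinnedSlopeCertificate

/-!
# Pinned-slope certificates, part D: words that need `PSL(2,7)`

Companion to `SoloInformedPinnedSlopeCertificate` (parts A–C).  For a cyclically reduced odd word
`w` in `π₁(P) = F⟨s,t⟩` (a section `γ_w` of `N_P = P ×_c S¹`), THEOREM 11.42 of the residency file
pins the only possible solid-Klein-bottle filling slope of `N_P ∖ ν(γ_w)` to ONE integer `x*(w)` by
homology alone (the capped filling must be `S¹ × S²`); the filling `N_{x*}(w)` is a solid Klein
bottle iff its fundamental group is `ℤ`.  For the three length-11 words below the filling group has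
NO non-abelian image inside `S₅` (exhaustive search over `A₅³` and the parity-admissible part of
`S₅³` after Tietze reduction to three generators; census job `j078178`, script
`work/s14/qcensus_v3.py`), but it does map onto `PSL(2,7) < S₈` (acting on `P¹(𝔽₇)`): the images
below were found by that search and are re-verified here by the kernel on the ORIGINAL six-generator
presentation (thirteen relators: five `τ g τ⁻¹ = ĥ_w(g)` with the stable letter filled at slope
`x*`, one cusp relation, five `y g y⁻¹ = ι(g)`, `y² = ι²`, `y τ y⁻¹ = z τ`; generators `a,…,e` =
fibre group, `y` = orientation-reversing lift `ι̂`). As in parts A–C, the identification of `G R_w`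
with `π₁(N_{x*(w)}(w))` is established in prose and by the scripts, not formalised; what the kernel
certifies is `IsEmpty (G R_w ≃* ℤ)` for the listed presentations. The appearance of `PSL(2,7)` (and
never of a solvable non-abelian group) is forced: the commutator subgroup of these knot-exterior
groups is perfect (COROLLARY 11.43(c) of the residency file).
-/

namespace Summit.SmoothPoincare4.SmoothPoincare4.Theorems.PinnedSlopeD

open Summit.SmoothPoincare4.SmoothPoincare4.Theorems.PinnedSlope

/-! ## Generic-degree evaluation (part A fixed degree 5) -/

/-- Evaluate a word on six permutations of `Fin n`. -/
def evalPn {n : ℕ} (f : Fin 6 → Equiv.Perm (Fin n)) (L : W) : Equiv.Perm (Fin n) :=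
  (L.map fun x => cond x.2 (f x.1) (f x.1)⁻¹).prod

/-- A homomorphism `G R → S_n` from six permutations satisfying the relators. -/
def toPermN {n : ℕ} (R : List W) (f : Fin 6 → Equiv.Perm (Fin n))
    (h : ∀ L ∈ R, evalPn f L = 1) : G R →* Equiv.Perm (Fin n) :=
  PresentedGroup.toGroup (f := f) (by
    rintro r ⟨L, hL, rfl⟩
    rw [FreeGroup.lift_mk]
    exact h L hL)

/-- `toPermN` on generators. -/
@[simp] theorem toPermN_of {n : ℕ} (R : List W) (f : Fin 6 → Equiv.Perm (Fin n))
    (h : ∀ L ∈ R, evalPn f L = 1) (i : Fin 6) :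
    toPermN R f h (PresentedGroup.of i) = f i := by
  simp [toPermN]

/-- Non-commuting generator images give a non-commutative presented group … -/
theorem of_mul_of_ne_n {n : ℕ} (R : List W) (f : Fin 6 → Equiv.Perm (Fin n))
    (h : ∀ L ∈ R, evalPn f L = 1) (i j : Fin 6) (hij : f i * f j ≠ f j * f i) :
    (PresentedGroup.of i : G R) * PresentedGroup.of j ≠
      PresentedGroup.of j * PresentedGroup.of i := by
  intro hc
  have := congrArg (toPermN R f h) hc
  simp only [map_mul, toPermN_of] at this
  exact hij this

/-- … which is therefore not isomorphic to `ℤ`. -/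
theorem isEmpty_mulEquiv_int_n {n : ℕ} (R : List W) (f : Fin 6 → Equiv.Perm (Fin n))
    (h : ∀ L ∈ R, evalPn f L = 1) (i j : Fin 6) (hij : f i * f j ≠ f j * f i) :
    IsEmpty (G R ≃* Multiplicative ℤ) := by
  refine ⟨fun q => of_mul_of_ne_n R f h i j hij ?_⟩
  apply q.injective
  rw [map_mul, map_mul, mul_comm]

/-! ## The three `PSL(2,7)` words -/

/-- Relators of `π₁(N_{x*}(w))`, `w = SSSTssssTss`, `x*(w) = 0` (1114 letters in 13
relators). -/
def R_SSSTssssTss : List W :=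
  [[b, E, D, E, d, e, A, b, E, C, E, b, e, B, e, d, C, E, b, e, B, e, c, D, E, b, E, B, e, c, D,
     E, d, e, A, e, d, C, E, b, e, B, e, d, C, E, b, E, B, e, c, D, E, a, E, D, e, d, e, B, a, E,
     D, E, d, e, A, b, E, D, E, d, e, A, e, d, C, E, b, e, B, e, d, C, E, b, E, B, e, c, D, E, a,
     E, D, e, d, e, B, a, E, D, B, e, c, D, E, b, E, B, e, c, e, B, a, E, D, e, d, e],
   [b, E, D, E, d, e, A, b, E, C, E, b, e, B, e, d, C, E, b, e, B, e, c, D, E, b, E, B, e, c, D,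
     E, d, e, A, e, d, C, E, b, e, B, e, d, C, E, b, E, B, e, c, D, E, a, E, D, e, d, e, B, a, E,
     D, E, d, e, A, b, E, D, E, d, e, A, e, d, C, E, b, e, B, e, d, C, E, b, E, B, e, c, D, E, a,
     E, D, e, d, e, B, a, E, D, B, e, c, D, E, b, E, B, e, c, e, B, a, E, D, e, d, e],
   [c, E, D, E, d, e, A, b, E, C, E, b, e, B, e, d, C, E, b, e, B, e, c, D, E, b, E, B, e, c, e,
     B, a, E, D, e, d, e, A, b, E, D, E, d, e, A, b, E, C, E, b, e, B, e, d, C, E, b, e, B, e, c,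
     D, E, b, E, B, e, c, D, E, d, e, A, e, d, C, E, b, e, B, e, d, C, E, b, E, B, e, c, D, E, a,
     E, D, e, d, e, B, a, E, D, E, d, e, A, b, E, D, E, d, e, A, e, d, C, E, b, e, B, e, d, C, E,
     b, E, B, e, c, D, E, a, E, D, e, d, e, B, a, E, D, B, e, c, D, E, b, E, B, e, c, e, B, a, E,
     D, e, d, e],
   [d, E, D, E, d, e, A, b, E, C, E, b, e, B, e, d, C, E, b, d, e, A, b, E, D, E, d, e, A, e, d,
     C, E, b, e, B, e, c, D, E, b, E, B, e, c, D, E, a, E, D, e, d, e, B, a, E, D, e, B, e, c, D,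
     E, b, E, B, e, c, e, B, a, E, D, e, d, e, A, b, E, D, E, d, e, A, b, E, C, E, b, e, B, e, d,
     C, E, b, e, B, e, c, D, E, b, E, B, e, c, D, E, d, e, A, e, d, C, E, b, e, B, e, d, C, E, b,
     E, B, e, c, D, E, a, E, D, e, d, e, B, a, E, D, E, d, e, A, b, E, D, E, d, e, A, e, d, C, E,
     b, e, B, e, d, C, E, b, E, B, e, c, D, E, a, E, D, e, d, e, B, a, E, D, B, e, c, D, E, b, E,
     B, e, c, e, B, a, E, D, e, d, e],
   [D, E, d, e, A, b, E, C, E, b, e, B, e, d, C, E, b, d, e, A, b, E, D, E, d, e, A, e, d, C, E,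
     b, e, B, e, c, D, E, b, E, B, e, c, D, E, a, E, D, e, d, e, B, a, E, D, e, d, e, A, b, E, D,
     E, d, e, A, b, E, B, e, c, e, B, a, E, D, e, d, e, B, a, E, D, E, d, e, A, b, E, D, E, d, e,
     A, e, d, C, E, b, e, B, e, d, C, E, b, E, B, e, c, D, E, a, E, D, e, d, e, B, a, E, D, E, d,
     e, A, b, E, D, E, d, e, A, e, d, C, E, b, e, B, e, d, C, E, b, E, B, e, c, D, E, a, E, D, e,
     d, e, B, a, E, D, B, e, c, D, E, b, E, B, e, c, e, B, a, E, D, e, d, e],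
   [b, E, B, e, c, D, E, a, E, D, e, d, e, B, a, E, D, e, B, e, c, D, E, b, E, B, e, c, e, B, a,
     E, D, e, d, e, A, b, E, D, E, d, e, A, b, E, C, E, b, e, B, e, d, C, E, b, e, B, e, c, D, E,
     b, E, B, e, c, D, E, d, e, A, e, d, C, E, b, e, B, e, d, C, E, b, E, B, e, c, D, E, a, E, D,
     e, d, e, B, a, E, D, E, d, e, A, b, E, D, E, d, e, A, e, d, C, E, b, e, B, e, d, C, E, b, E,
     B, e, c, D, E, a, E, D, e, d, e, B, a, E, D, B, e, c, D, E, b, E, B, e, c, e, B, a, E, D, e,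
     d],
   [y, a, Y, c, E],
   [y, b, Y, d, E],
   [y, c, Y, a, E],
   [y, d, Y, b, E],
   [y, e, Y, E],
   [y, y, E],
   [D, E, d, e, A, b, E, C, E, b, e, B, e, d, C, E, b, d, e, A, b, E, D, E, d, e, A, e, d, C, E,
     b, e, B, e, c, D, E, b, E, B, e, c, D, E, a, E, D, e, d, e, B, a, E, D, e, d, e, A, b, E, D,
     E, d, e, A, e, d, C, E, b, e, B, e, c, D, E, b, E, B, e, c, D, E, a, E, D, e, d, C, E, b, e,
     B, e, d, C, E, b, E, B, e, c, D, E, b, E, B, e, c, e, B, a, E, D, e, d, e, B, a, E, D, E, d,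
     e, A, b, E, C, E, b, e, B, e, d, C, E, b, E, d, e, A, b, E, D, E, d, e, A, e, d, C, E, b, e,
     B]]

/-- Generator images in `PSL(2,7) < S₈` for `w = SSSTssssTss` (image of order 168). -/
def f_SSSTssssTss : Fin 6 → Equiv.Perm (Fin 8) :=
  ![Equiv.swap 0 7 * Equiv.swap 7 5 * Equiv.swap 5 6 *
    Equiv.swap 1 3 * Equiv.swap 3 2 * Equiv.swap 2 4,
    Equiv.swap 0 2 * Equiv.swap 2 6 * Equiv.swap 6 4 *
      Equiv.swap 4 7 * Equiv.swap 7 5 * Equiv.swap 5 3,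
    Equiv.swap 2 6 * Equiv.swap 6 7 * Equiv.swap 3 5 * Equiv.swap 5 4,
    Equiv.swap 1 2 * Equiv.swap 2 4 * Equiv.swap 3 6 * Equiv.swap 6 5,
    Equiv.swap 0 3 * Equiv.swap 1 6 * Equiv.swap 2 4 * Equiv.swap 5 7,
    Equiv.swap 0 5 * Equiv.swap 5 3 * Equiv.swap 3 7 *
      Equiv.swap 1 4 * Equiv.swap 4 6 * Equiv.swap 6 2]

set_option maxRecDepth 32768 in
/-- Every relator of `R_SSSTssssTss` holds for `f_SSSTssssTss`. -/
theorem rels_SSSTssssTss : ∀ L ∈ R_SSSTssssTss, evalPn f_SSSTssssTss L = 1 := by decide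

/-- Two generator images do not commute. -/
theorem nc_SSSTssssTss : f_SSSTssssTss 0 * f_SSSTssssTss 1 ≠ f_SSSTssssTss 1 * f_SSSTssssTss 0 := by
  decide

/-- MAIN (SSSTssssTss): the pinned-slope filling group of `γ_w`, `w = SSSTssssTss`, is not `ℤ`. -/
theorem isEmpty_G_SSSTssssTss_mulEquiv_int : IsEmpty (G R_SSSTssssTss ≃* Multiplicative ℤ) :=
  isEmpty_mulEquiv_int_n R_SSSTssssTss f_SSSTssssTss rels_SSSTssssTss 0 1 nc_SSSTssssTss

/-- Relators of `π₁(N_{x*}(w))`, `w = SSSStSSttts`, `x*(w) = 0` (1160 letters in 13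
relators). -/
def R_SSSStSSttts : List W :=
  [[b, E, d, d, C, B, d, e, A, b, c, D, D, e, B, a, E, d, B, e, c, D, D, b, c, D, B, e, B, a, E,
     d, C, E, b, D, e, A, b, E, b, d, C, B, e, B, a, E, d, B, e, c, D, e, A, b, E, b, D, e, A, b,
     E, d, d, C, B, d, e, A, b, c, D, D, e, B, a, E, d, B, e, B, a, E, d, C, E, b, D, e, A, b, E,
     d, d, C, B, a, E, D, b, c, D, D, e, A, b, E, d, d, C, B, d, e, A, b, c, D, D, e, B, a, E, d,
     B, e, B, a, E, d, C, E, b, D, e, A, b, E, d, d, C, B, a, E, D, b, c, D, D, e],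
   [b, E, d, d, C, B, d, e, A, b, c, D, D, e, B, a, E, d, B, e, c, D, D, b, c, D, B, e, B, a, E,
     d, C, E, b, D, e, A, b, E, b, d, C, B, e, B, a, E, d, B, e, c, D, e, A, b, E, b, D, e, A, b,
     E, d, d, C, B, d, e, A, b, c, D, D, e, B, a, E, d, B, e, B, a, E, d, C, E, b, D, e, A, b, E,
     d, d, C, B, a, E, D, b, c, D, D, e, A, b, E, d, d, C, B, d, e, A, b, c, D, D, e, B, a, E, d,
     B, e, B, a, E, d, C, E, b, D, e, A, b, E, d, d, C, B, a, E, D, b, c, D, D, e],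
   [c, E, d, d, C, B, d, e, A, b, c, D, D, e, B, a, E, d, B, e, c, D, D, b, c, D, B, e, B, a, E,
     d, C, E, b, D, e, A, b, E, b, d, C, B, e, B, a, E, d, B, e, c, D, e, A, b, E, b, d, C, B, d,
     e, A, b, c, D, D, b, c, D, B, e, B, a, E, d, C, E, b, D, e, A, b, E, b, d, C, B, e, B, a, E,
     d, B, e, c, D, e, A, b, E, b, D, e, A, b, E, d, d, C, B, d, e, A, b, c, D, D, e, B, a, E, d,
     B, e, B, a, E, d, C, E, b, D, e, A, b, E, d, d, C, B, a, E, D, b, c, D, D, e, A, b, E, d, d,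
     C, B, d, e, A, b, c, D, D, e, B, a, E, d, B, e, B, a, E, d, C, E, b, D, e, A, b, E, d, d, C,
     B, a, E, D, b, c, D, D, e],
   [d, E, d, d, C, B, d, e, A, b, c, D, D, e, B, a, E, d, B, e, c, D, e, A, b, c, D, D, b, c, D,
     B, e, B, a, E, d, C, E, b, D, e, A, b, E, b, d, C, B, e, B, a, E, d, B, e, c, D, e, A, b, E,
     b, D, e, A, b, E, d, d, C, B, d, e, A, b, c, D, D, e, B, a, E, d, B, e, B, a, E, d, C, E, b,
     D, e, A, b, E, d, d, C, B, a, E, D, b, c, D, D, e, A, b, E, d, d, C, B, d, e, A, b, c, D, D,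
     e, B, a, E, d, B, e, B, a, E, d, C, E, b, D, e, A, b, E, d, d, C, B, a, E, D, b, c, D, D, e],
   [d, d, C, B, d, e, A, b, c, D, D, e, B, a, E, d, B, e, c, D, e, A, b, E, b, D, e, A, b, E, d,
     d, C, B, a, E, D, b, c, D, D, e, B, a, E, d, d, C, B, d, e, A, b, c, D, D, b, c, D, B, e, B,
     a, E, d, B, e, c, D, e, A, b, E, b, d, C, B, d, d, C, B, a, E, D, b, c, D, D, e, A, b, E, d,
     d, C, B, d, e, A, b, c, D, D, e, B, a, E, d, B, e, B, a, E, d, C, E, b, D, e, A, b, E, d, d,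
     C, B, a, E, D, b, c, D, D, e, A, b, E, d, d, C, B, d, e, A, b, c, D, D, e, B, a, E, d, B, e,
     B, a, E, d, C, E, b, D, e, A, b, E, d, d, C, B, a, E, D, b, c, D, D, e],
   [B, e, B, a, E, d, B, e, c, D, e, A, b, E, b, d, C, B, d, e, A, b, c, D, D, b, c, D, B, e, B,
     a, E, d, C, E, b, D, e, A, b, E, b, d, C, B, e, B, a, E, d, B, e, c, D, e, A, b, E, b, D, e,
     A, b, E, d, d, C, B, d, e, A, b, c, D, D, e, B, a, E, d, B, e, B, a, E, d, C, E, b, D, e, A,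
     b, E, d, d, C, B, a, E, D, b, c, D, D, e, A, b, E, d, d, C, B, d, e, A, b, c, D, D, e, B, a,
     E, d, B, e, B, a, E, d, C, E, b, D, e, A, b, E, d, d, C, B, a, E, D, b, c, D, D, e],
   [y, a, Y, c, E],
   [y, b, Y, d, E],
   [y, c, Y, a, E],
   [y, d, Y, b, E],
   [y, e, Y, E],
   [y, y, E],
   [E, d, d, C, B, d, e, A, b, c, D, D, e, B, a, E, d, B, e, c, D, e, A, b, E, b, D, e, A, b, E,
     d, d, C, B, a, E, D, b, c, D, D, e, B, a, E, d, d, C, B, d, e, A, b, c, D, D, e, B, a, E, d,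
     B, e, c, D, e, A, b, E, b, D, e, A, b, E, d, d, C, B, a, E, D, b, c, D, D, e, B, a, E, d, B,
     e, B, a, E, d, C, E, b, D, e, A, b, E, b, c, D, B, e, B, a, E, d, B, e, c, D, e, A, b, E, b,
     d, C, B, d, d, C, B, a, E, D, b, c, D, B, e, B, a, E, d, C, E, b, D, e, A, b, E, b]]

/-- Generator images in `PSL(2,7) < S₈` for `w = SSSStSSttts` (image of order 168). -/
def f_SSSStSSttts : Fin 6 → Equiv.Perm (Fin 8) :=
  ![Equiv.swap 0 6 * Equiv.swap 6 4 * Equiv.swap 2 3 * Equiv.swap 3 5,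
    Equiv.swap 0 7 * Equiv.swap 1 6 * Equiv.swap 2 3 * Equiv.swap 4 5,
    Equiv.swap 2 6 * Equiv.swap 6 7 * Equiv.swap 3 5 * Equiv.swap 5 4,
    Equiv.swap 1 2 * Equiv.swap 2 4 * Equiv.swap 3 6 * Equiv.swap 6 5,
    Equiv.swap 0 5 * Equiv.swap 5 4 * Equiv.swap 4 2 *
      Equiv.swap 2 3 * Equiv.swap 3 7 * Equiv.swap 7 6,
    Equiv.swap 0 3 * Equiv.swap 3 5 * Equiv.swap 5 7 *
      Equiv.swap 7 4 * Equiv.swap 4 6 * Equiv.swap 6 2]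

set_option maxRecDepth 32768 in
/-- Every relator of `R_SSSStSSttts` holds for `f_SSSStSSttts`. -/
theorem rels_SSSStSSttts : ∀ L ∈ R_SSSStSSttts, evalPn f_SSSStSSttts L = 1 := by decide

/-- Two generator images do not commute. -/
theorem nc_SSSStSSttts : f_SSSStSSttts 0 * f_SSSStSSttts 1 ≠ f_SSSStSSttts 1 * f_SSSStSSttts 0 := by
  decide

/-- MAIN (SSSStSSttts): the pinned-slope filling group of `γ_w`, `w = SSSStSSttts`, is not `ℤ`. -/
theorem isEmpty_G_SSSStSSttts_mulEquiv_int : IsEmpty (G R_SSSStSSttts ≃* Multiplicative ℤ) :=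
  isEmpty_mulEquiv_int_n R_SSSStSSttts f_SSSStSSttts rels_SSSStSSttts 0 1 nc_SSSStSSttts

/-- Relators of `π₁(N_{x*}(w))`, `w = SSSttSttttS`, `x*(w) = 0` (1272 letters in 13
relators). -/
def R_SSSttSttttS : List W :=
  [[b, c, B, d, C, B, a, c, B, d, C, e, A, d, c, D, b, C, A, b, c, D, b, C, B, a, c, B, d, C, B,
     a, c, B, e, A, b, D, a, E, c, D, e, A, d, C, B, a, c, B, d, C, D, a, E, c, D, e, A, b, D, a,
     E, c, D, e, A, d, B, a, E, d, C, e, A, d, B, a, E, b, C, A, b, D, a, E, c, D, e, A, b, D, a,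
     E, d, C, e, A, d, B, a, E, d, C, e, A, d, c, D, b, C, A, b, c, B, d, C, B, a, c, B, d, C, D,
     a, E, c, D, b, C, A, b, c, D, b, C],
   [b, c, B, d, C, B, a, c, B, d, C, e, A, d, c, D, b, C, A, b, c, D, b, C, B, a, c, B, d, C, B,
     a, c, B, e, A, b, D, a, E, c, D, e, A, d, C, B, a, c, B, d, C, D, a, E, c, D, e, A, b, D, a,
     E, c, D, e, A, d, B, a, E, d, C, e, A, d, B, a, E, b, C, A, b, D, a, E, c, D, e, A, b, D, a,
     E, d, C, e, A, d, B, a, E, d, C, e, A, d, c, D, b, C, A, b, c, B, d, C, B, a, c, B, d, C, D,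
     a, E, c, D, b, C, A, b, c, D, b, C],
   [c, B, d, C, B, a, c, B, d, C, e, A, d, c, D, b, C, A, b, c, D, b, C, B, a, c, B, d, C, B, a,
     c, B, e, A, b, D, a, E, c, D, e, A, b, D, a, E, d, C, e, A, d, B, a, E, b, C, A, b, c, D, b,
     C, A, b, c, B, d, C, B, a, c, B, d, C, e, A, d, c, D, b, C, A, b, c, D, b, C, B, a, c, B, d,
     C, B, a, c, B, e, A, b, D, a, E, c, D, e, A, d, C, B, a, c, B, d, C, D, a, E, c, D, e, A, b,
     D, a, E, c, D, e, A, d, B, a, E, d, C, e, A, d, B, a, E, b, C, A, b, D, a, E, c, D, e, A, b,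
     D, a, E, d, C, e, A, d, B, a, E, d, C, e, A, d, c, D, b, C, A, b, c, B, d, C, B, a, c, B, d,
     C, D, a, E, c, D, b, C, A, b, c, D, b],
   [d, c, B, d, C, B, a, c, B, d, C, e, A, d, c, D, b, C, A, b, c, D, b, C, B, a, c, B, d, C, D,
     a, E, c, D, e, A, b, D, a, E, c, D, e, A, d, B, a, E, d, C, e, A, d, B, a, c, B, e, A, b, D,
     a, E, c, D, e, A, b, D, a, E, d, C, e, A, d, B, a, E, b, C, A, b, c, D, b, C, A, b, c, B, d,
     C, B, a, c, B, d, C, e, A, d, c, D, b, C, A, b, c, D, b, C, B, a, c, B, d, C, B, a, c, B, e,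
     A, b, D, a, E, c, D, e, A, d, C, B, a, c, B, d, C, D, a, E, c, D, e, A, b, D, a, E, c, D, e,
     A, d, B, a, E, d, C, e, A, d, B, a, E, b, C, A, b, D, a, E, c, D, e, A, b, D, a, E, d, C, e,
     A, d, B, a, E, d, C, e, A, d, c, D, b, C, A, b, c, B, d, C, B, a, c, B, d, C, D, a, E, c, D,
     b, C, A, b, c, D, b, C],
   [e, c, B, d, C, B, a, c, B, d, C, e, A, d, c, D, b, C, A, b, c, D, b, C, B, a, c, B, d, C, D,
     a, E, c, D, e, A, b, D, a, E, c, D, e, A, d, B, a, E, d, C, e, A, d, B, a, c, B, e, A, b, D,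
     a, E, c, D, e, A, b, D, a, E, d, C, e, A, d, B, a, E, d, C, e, A, d, c, D, b, C, A, b, c, B,
     d, C, B, a, c, B, d, C, D, a, E, c, D, e, A, b, D, a, E, c, D, e, A, d, B, a, E, d, C, e, A,
     d, B, a, E, b, C, A, b, D, a, E, c, D, e, A, b, D, a, E, d, C, e, A, d, B, a, E, d, C, e, A,
     d, c, D, b, C, A, b, c, B, d, C, B, a, c, B, d, C, D, a, E, c, D, b, C, A, b, c, D, b, C],
   [e, A, d, B, a, E, d, C, e, A, d, B, a, c, B, e, A, b, D, a, E, c, D, e, A, b, D, a, E, d, C,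
     e, A, d, B, a, E, b, C, A, b, c, D, b, C, A, b, c, B, d, C, B, a, c, B, d, C, e, A, d, c, D,
     b, C, A, b, c, D, b, C, B, a, c, B, d, C, B, a, c, B, e, A, b, D, a, E, c, D, e, A, d, C, B,
     a, c, B, d, C, D, a, E, c, D, e, A, b, D, a, E, c, D, e, A, d, B, a, E, d, C, e, A, d, B, a,
     E, b, C, A, b, D, a, E, c, D, e, A, b, D, a, E, d, C, e, A, d, B, a, E, d, C, e, A, d, c, D,
     b, C, A, b, c, B, d, C, B, a, c, B, d, C, D, a, E, c, D, b, C, A, b, c, D, b, C],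
   [y, a, Y, c, E],
   [y, b, Y, d, E],
   [y, c, Y, a, E],
   [y, d, Y, b, E],
   [y, e, Y, E],
   [y, y, E],
   [c, B, d, C, B, a, c, B, d, C, e, A, d, c, D, b, C, A, b, c, D, b, C, B, a, c, B, d, C, D, a,
     E, c, D, e, A, b, D, a, E, c, D, e, A, d, B, a, E, d, C, e, A, d, B, a, c, B, e, A, b, D, a,
     E, c, D, e, A, b, D, a, E, d, C, e, A, d, B, a, E, d, C, e, A, d, c, D, b, C, A, b, c, D, a,
     E, d, C, e, A, d, B, a, E, b, C, A, b, c, D, b, C, A, b, c, B, d, C, B, a, c, B, d, C, D, a,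
     E, c, D, b, C, A, b, c, D, b, C, B, a, c, B, d, C, B, a, c, B, e, A, b, D, a, E, c, D, e, A,
     d, B, a, E, d, C, e, A, d, B, a, E, b, C, A, b, D, a, E, c, D, e, A, b, D, a, E]]

/-- Generator images in `PSL(2,7) < S₈` for `w = SSSttSttttS` (image of order 168). -/
def f_SSSttSttttS : Fin 6 → Equiv.Perm (Fin 8) :=
  ![Equiv.swap 0 7 * Equiv.swap 7 5 * Equiv.swap 5 2 *
    Equiv.swap 2 1 * Equiv.swap 1 4 * Equiv.swap 4 3,
    Equiv.swap 0 7 * Equiv.swap 7 3 * Equiv.swap 3 5 *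
      Equiv.swap 1 2 * Equiv.swap 2 6 * Equiv.swap 6 4,
    Equiv.swap 2 6 * Equiv.swap 6 7 * Equiv.swap 3 5 * Equiv.swap 5 4,
    Equiv.swap 0 2 * Equiv.swap 2 1 * Equiv.swap 1 7 *
      Equiv.swap 7 5 * Equiv.swap 5 4 * Equiv.swap 4 6,
    Equiv.swap 0 3 * Equiv.swap 1 4 * Equiv.swap 2 7 * Equiv.swap 5 6,
    Equiv.swap 0 4 * Equiv.swap 4 3 * Equiv.swap 3 1 *
      Equiv.swap 2 5 * Equiv.swap 5 7 * Equiv.swap 7 6]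

set_option maxRecDepth 32768 in
/-- Every relator of `R_SSSttSttttS` holds for `f_SSSttSttttS`. -/
theorem rels_SSSttSttttS : ∀ L ∈ R_SSSttSttttS, evalPn f_SSSttSttttS L = 1 := by decide

/-- Two generator images do not commute. -/
theorem nc_SSSttSttttS : f_SSSttSttttS 0 * f_SSSttSttttS 1 ≠ f_SSSttSttttS 1 * f_SSSttSttttS 0 := by
  decide

/-- MAIN (SSSttSttttS): the pinned-slope filling group of `γ_w`, `w = SSSttSttttS`, is not `ℤ`. -/
theorem isEmpty_G_SSSttSttttS_mulEquiv_int : IsEmpty (G R_SSSttSttttS ≃* Multiplicative ℤ) :=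
  isEmpty_mulEquiv_int_n R_SSSttSttttS f_SSSttSttttS rels_SSSttSttttS 0 1 nc_SSSttSttttS

end Summit.SmoothPoincare4.SmoothPoincare4.Theorems.PinnedSlopeD
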